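import Literature.MathematicalPhysics.QuantumFieldTheory.Balaban1983to89.B13Lemma1Eq130

/-!
# `Balaban1983to89.B13Lemma1DepGather` — T. Bałaban, *Renormalization group approach to lattice gauge field theories.
II. Cluster expansions*, Commun. Math. Phys. **116** (1988) 1–22, doi:10.1007/bf01239022 [Balaban1988RG2Cluster]:
**the nested-sum bookkeeping of pp. 8–9 with □₀-DEPENDENT index families and a SCALE-HONEST □′-count** — the scalar
certificates `B13Sect1Arith.gather_129` ((1.29), the (I.3.34)-type terms) and `B13Lemma1Eq130.gather_p9` (p. 9, the
(I.3.7)-type terms) re-proved with (i) the families of cubes □′ ⊂ □̃² and of domains X ∋ □′ allowed to depend on the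
big cube □₀ (resp. □) they belong to, as in print, and (ii) the □′-sum of the (I.3.7)-chain allowed to grow like
(L^jη)⁻⁴ — the number of cubes of π_j inside a fixed cube of the k-th scale — compensated by the first exponential
exp(−½δ₀M(L^jη)⁻¹) of (1.30) under the threshold δ₀M ≥ 10e⁻¹

statement-level skeleton of published theorems with citation tags; proofs where landed; nothing here is a claim about
the Yang–Mills mass gap

PDF held: `paper:balaban1988-cmp116-rg-ii-cluster` (journal page = PDF page + 0); pp. 8–9 re-read this session as
images (`b2b-balaban-ref1/pages/…-p008-x2.png`, `…-p009-x2.png`) and from the text layer.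

CITATION HEADER / WHAT IS REPRODUCED (cell `pub-ymgap`, Track A node N10 = [B13], prover seat `pub-ymgap-dag-p2`,
seventh module; a NEW LEAF over `B13Lemma1Eq130` (p403609), nothing there modified).  p. 8 [PDF 8], verbatim: *"At
first we consider the sum over X. We take X ∈ 𝐃_j, X ⊂ □̃². This sum can be bounded by two sums, the first is over
□′ ∈ π_j, □′ ⊂ □̃², the second over X ∈ 𝐃_j such that □′ ⊂ X. … To bound the first sum, over □′ ⊂ □̃², we use the
factor (L^jη)⁵ in (1.24). This yields (6L)⁴L^jη, and the sum over j is bounded by 2(6L)⁴."*; p. 9 [PDF 9]: *"We fix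
a cube □′ ∈ π_j such, that □′ ⊂ X, dist^{(ξ)}(X, □) = dist^{(ξ)}(□′, □), and we sum over X containing □′, using the
second exponential in (1.32), and the inequality (1.26) for δκ sufficiently large. Next we sum over the cubes □′, and
this sum is controlled by the first exponential in (1.30). The first term under the exponential gives also the factor
L^jη, which controls the sum over j."*
WHY A NEW VERSION (modelling, not mathematics of the paper; cell DIVERGENCE D-pv20.5 lifted): in `gather_129` /
`B13Lemma1Assembly` the families {□′ ⊂ □̃²}, {X ∋ □′} are indexed WITHOUT their dependence on □₀ (*"the printed counts
are uniform in □₀"*) — faithful for the COUNTS but not for the DECOMPOSITION (1.33) once □̃² is a concrete block of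
[I]'s geometry; and in `gather_p9` the □′-sum Σ_{□′∈π_j} exp(−½δ₀dist^{(ξ)}(□′, □)) is carried with a j-UNIFORM
constant O₂, whereas the cubes □′ ∈ π_j lying inside the k-scale cube □ alone number (2(L^jη)⁻¹)⁴ — the honest level
bound is O₂·(L^jη)⁻⁴, and print's sentence *"The first term under the exponential gives also the factor L^jη"* then
needs exp(−½δ₀M(L^jη)⁻¹) ≤ (L^jη)⁵, i.e. δ₀M ≥ 10e⁻¹ (`factor_Ljη_pow5`; print p. 21: *"we take M sufficiently
large, so that δ₀M ≥ κ"*).  Both are repaired here at the scalar level, with the index TYPES of □′ and X allowed to depend on the scale j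
(`γ j`, `δ j` — on the torus tower the cubes of π_j live in `TPt 4 (L^{k−j}·N)`, no Σ-packaging needed):
* `factor_Ljη_pow5` — exp(−½aℓ⁻¹) ≤ ℓ⁵ for 0 < ℓ and a ≥ 10e⁻¹ (from x⁵e^{−x} ≤ (5/e)⁵);
* `gather_129_dep` — (1.29)'s nested sum with `Sq □₀ j`, `SX □₀ j □′`, `dj □₀ j □′ X`;
* `gather_p9_dep` — p. 9's nested sum with the □′-level bound `O₂·(L^jη)⁻⁴` and δ₀M ≥ 10e⁻¹, the □-count as an
  abstract `Cnt` (conclusion `2K′O(1)O₂·Cnt·exp(−(1 − δ)κd_k(Y))`, = print's form at Cnt = e^{δκd_k(Y)}).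
HONEST FRAMING: a count-neutral Track-A side landing (YM-PLAN §1); NOT a discharge of node N10; one finite T⁴ programme
at fixed ε; Bałaban's statements AS PRINTED with page locators; nothing continuum / OS / mass-gap / Clay.
-/

noncomputable section

namespace Literature.MathematicalPhysics.QuantumFieldTheory.Balaban1983to89.B13Lemma1DepGather

open Literature.MathematicalPhysics.QuantumFieldTheory.Balaban1983to89
open Literature.MathematicalPhysics.QuantumFieldTheory.Balaban1983to89.B13Sect1Arith (sum_le_card_mul exponent_129)
open Literature.MathematicalPhysics.QuantumFieldTheory.Balaban1983to89.B13Lemma1Eq130 (jsum_le_two)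

/-! ## §1. The factor (L^jη)⁵ from the first exponential of (1.30) -/

/-- p. 9 [PDF 9], verbatim: *"Next we sum over the cubes □′, and this sum is controlled by the first exponential in
(1.30). The first term under the exponential gives also the factor L^jη, which controls the sum over j."* — the first
term being −½δ₀M(L^jη)⁻¹.  KERNEL FORM absorbing the count of the cubes of π_j inside a k-scale cube as well:
exp(−½a/ℓ) ≤ ℓ⁵ for every 0 < ℓ (= L^jη) as soon as a (= δ₀M) ≥ 10e⁻¹, from x⁵e^{−x} ≤ (5/e)⁵ at x = a/(2ℓ) (the
sibling `B13Sect1Arith.factor_Ljη` is the first power, threshold 2e⁻¹). [cite: Balaban1988RG2Cluster, (1.30) p.9] -/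
theorem factor_Ljη_pow5 {a ℓ : ℝ} (hℓ : 0 < ℓ) (ha : 10 * Real.exp (-1) ≤ a) :
    Real.exp (-(1 / 2) * a * ℓ⁻¹) ≤ ℓ ^ 5 := by
  have he : 0 < Real.exp (-1) := Real.exp_pos _
  have ha0 : 0 < a := lt_of_lt_of_le (by positivity) ha
  set x := (1 / 2) * a * ℓ⁻¹ with hx
  have hx0 : 0 < x := by positivity
  -- (x/5)⁵ ≤ e^{x−5}, i.e. x⁵e^{−x} ≤ 5⁵e^{−5}
  have h1 : x / 5 ≤ Real.exp (x / 5 - 1) := by have := Real.add_one_le_exp (x / 5 - 1); linarith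
  have h2 : (x / 5) ^ 5 ≤ Real.exp (x - 5) := by
    calc (x / 5) ^ 5 ≤ Real.exp (x / 5 - 1) ^ 5 := pow_le_pow_left₀ (by positivity) h1 5
      _ = Real.exp (x - 5) := by rw [← Real.exp_nat_mul]; ring_nf
  -- hence e^{−x} ≤ (5e^{−1}/x)⁵
  have h3 : Real.exp (-x) ≤ (5 * Real.exp (-1) / x) ^ 5 := by
    have hx5 : 0 < x ^ 5 := by positivity
    have e1 : (5 * Real.exp (-1) / x) ^ 5 = 5 ^ 5 * Real.exp (-5) / x ^ 5 := by
      rw [div_pow, mul_pow, ← Real.exp_nat_mul]; ring_nf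
    rw [e1, le_div_iff₀ hx5]
    have e2 : (x / 5) ^ 5 = x ^ 5 / 5 ^ 5 := by rw [div_pow]
    rw [e2, div_le_iff₀ (by norm_num : (0:ℝ) < 5 ^ 5)] at h2
    have e3 : Real.exp (x - 5) * 5 ^ 5 = 5 ^ 5 * Real.exp (-5) * Real.exp x := by
      rw [mul_assoc, ← Real.exp_add]; ring_nf
    rw [e3] at h2
    have e4 : Real.exp (-x) * x ^ 5 * Real.exp x = x ^ 5 := by
      rw [mul_assoc, mul_comm (x ^ 5), ← mul_assoc, ← Real.exp_add]; simp
    nlinarith [Real.exp_pos x, Real.exp_pos (-x)]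
  -- and 5e^{−1}/x ≤ ℓ because ℓ·x = a/2 ≥ 5e^{−1}
  have h4 : 5 * Real.exp (-1) / x ≤ ℓ := by
    rw [div_le_iff₀ hx0, hx]
    have : ℓ * ((1 / 2) * a * ℓ⁻¹) = (1 / 2) * a := by field_simp
    rw [this]; linarith
  have : -(1 / 2) * a * ℓ⁻¹ = -x := by rw [hx]; ring
  rw [this]
  exact h3.trans (pow_le_pow_left₀ (by positivity) h4 5)

/-! ## §2. (1.29) with □₀-dependent families -/

/-- **(1.29)** p. 8, *"Gathering together the above bounds"* — the NESTED-SUM BOOKKEEPING of `B13Sect1Arith.gather_129`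
with the families □′ ⊂ □̃² (`Sq □₀ j`), X ∋ □′ (`SX □₀ j □′`) and the lengths d_j(X) (`dj □₀ j □′ X`) DEPENDING ON □₀,
as in print (□̃² is the double enlargement of the cube □ ⊂ □₀ of [I] Sect. 3): terms bounded pointwise by (1.24)×(1.25)
(`hT`), level bounds (1.26) (`hX`), «(6L)⁴L^jη» (`hq`), «2(6L)⁴» (`hj`), (1.27) (`hY`), the outer inequality of
(1.28) (`h0`); conclusion K·O(1)·2(6L)⁴·e·exp(⅛κ₁d_k(□₀))·exp(−(1/16)κ₁d_k(Y)) with every factor explicit.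
[cite: Balaban1988RG2Cluster, (1.29) p.8] -/
theorem gather_129_dep {α β : Type*} {γ δ : ℕ → Type*} (S0 : Finset α) (SY : α → Finset β) (k : ℕ)
    (Sq : α → (j : ℕ) → Finset (γ j)) (SX : α → (j : ℕ) → γ j → Finset (δ j))
    (T : α → β → (j : ℕ) → γ j → δ j → ℝ) (ℓ : ℕ → ℝ) (dj : α → (j : ℕ) → γ j → δ j → ℝ) (n : α → β → ℝ)
    {K O1 L d d0 κ κ₁ : ℝ} (hK : 0 ≤ K) (hO1 : 0 ≤ O1) (hℓ : ∀ j, 0 ≤ ℓ j)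
    (hT : ∀ a ∈ S0, ∀ y ∈ SY a, ∀ j ∈ Finset.range (k + 1), ∀ q ∈ Sq a j, ∀ x ∈ SX a j q,
      T a y j q x ≤ K * ℓ j ^ 5 * Real.exp (-(κ * dj a j q x)) *
        Real.exp (-(1 / 8) * (κ₁ - 1) * d + (1 / 8) * κ₁ * d0 - (1 / 2) * (κ₁ - 1) * n a y))
    (hX : ∀ a ∈ S0, ∀ j ∈ Finset.range (k + 1), ∀ q ∈ Sq a j,
      ∑ x ∈ SX a j q, Real.exp (-(κ * dj a j q x)) ≤ O1)
    (hq : ∀ a ∈ S0, ∀ j ∈ Finset.range (k + 1), ((Sq a j).card : ℝ) * ℓ j ^ 5 ≤ (6 * L) ^ 4 * ℓ j)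
    (hj : ∑ j ∈ Finset.range (k + 1), (6 * L) ^ 4 * ℓ j ≤ 2 * (6 * L) ^ 4)
    (hY : ∀ a ∈ S0, ∑ y ∈ SY a, Real.exp (-(1 / 2) * (κ₁ - 1) * n a y) ≤ Real.exp 1)
    (h0 : (S0.card : ℝ) ≤ Real.exp ((1 / 16) * (κ₁ - 2) * d)) :
    ∑ a ∈ S0, ∑ y ∈ SY a, ∑ j ∈ Finset.range (k + 1), ∑ q ∈ Sq a j, ∑ x ∈ SX a j q, T a y j q x
      ≤ K * O1 * (2 * (6 * L) ^ 4) * Real.exp 1 * Real.exp ((1 / 8) * κ₁ * d0) *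
        Real.exp (-(1 / 16) * κ₁ * d) := by
  set A := Real.exp (-(1 / 8) * (κ₁ - 1) * d + (1 / 8) * κ₁ * d0) with hA
  have hsplit : ∀ a y, Real.exp (-(1 / 8) * (κ₁ - 1) * d + (1 / 8) * κ₁ * d0 - (1 / 2) * (κ₁ - 1) * n a y)
      = A * Real.exp (-(1 / 2) * (κ₁ - 1) * n a y) := by
    intro a y; rw [hA, ← Real.exp_add]; ring_nf
  -- level X
  have hLX : ∀ a ∈ S0, ∀ y ∈ SY a, ∀ j ∈ Finset.range (k + 1), ∀ q ∈ Sq a j,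
      ∑ x ∈ SX a j q, T a y j q x ≤ K * ℓ j ^ 5 * O1 * (A * Real.exp (-(1 / 2) * (κ₁ - 1) * n a y)) := by
    intro a ha y hy j hj' q hq'
    calc ∑ x ∈ SX a j q, T a y j q x
        ≤ ∑ x ∈ SX a j q, K * ℓ j ^ 5 * Real.exp (-(κ * dj a j q x)) *
            (A * Real.exp (-(1 / 2) * (κ₁ - 1) * n a y)) :=
          Finset.sum_le_sum fun x hx => by rw [← hsplit]; exact hT a ha y hy j hj' q hq' x hx
      _ = K * ℓ j ^ 5 * (A * Real.exp (-(1 / 2) * (κ₁ - 1) * n a y)) *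
            ∑ x ∈ SX a j q, Real.exp (-(κ * dj a j q x)) := by
          rw [Finset.mul_sum]; refine Finset.sum_congr rfl fun x _ => by ring
      _ ≤ K * ℓ j ^ 5 * (A * Real.exp (-(1 / 2) * (κ₁ - 1) * n a y)) * O1 :=
          mul_le_mul_of_nonneg_left (hX a ha j hj' q hq')
            (mul_nonneg (mul_nonneg hK (pow_nonneg (hℓ j) 5)) (by positivity))
      _ = _ := by ring
  -- level □′
  have hLq : ∀ a ∈ S0, ∀ y ∈ SY a, ∀ j ∈ Finset.range (k + 1),
      ∑ q ∈ Sq a j, ∑ x ∈ SX a j q, T a y j q x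
        ≤ K * O1 * ((6 * L) ^ 4 * ℓ j) * (A * Real.exp (-(1 / 2) * (κ₁ - 1) * n a y)) := by
    intro a ha y hy j hj'
    calc ∑ q ∈ Sq a j, ∑ x ∈ SX a j q, T a y j q x
        ≤ (Sq a j).card * (K * ℓ j ^ 5 * O1 * (A * Real.exp (-(1 / 2) * (κ₁ - 1) * n a y))) :=
          sum_le_card_mul _ _ _ fun q hq' => hLX a ha y hy j hj' q hq'
      _ = K * O1 * (((Sq a j).card : ℝ) * ℓ j ^ 5) * (A * Real.exp (-(1 / 2) * (κ₁ - 1) * n a y)) := by ring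
      _ ≤ K * O1 * ((6 * L) ^ 4 * ℓ j) * (A * Real.exp (-(1 / 2) * (κ₁ - 1) * n a y)) :=
          mul_le_mul_of_nonneg_right (mul_le_mul_of_nonneg_left (hq a ha j hj') (by positivity))
            (by positivity)
  -- level j
  have hLj : ∀ a ∈ S0, ∀ y ∈ SY a,
      ∑ j ∈ Finset.range (k + 1), ∑ q ∈ Sq a j, ∑ x ∈ SX a j q, T a y j q x
        ≤ K * O1 * (2 * (6 * L) ^ 4) * (A * Real.exp (-(1 / 2) * (κ₁ - 1) * n a y)) := by
    intro a ha y hy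
    calc ∑ j ∈ Finset.range (k + 1), ∑ q ∈ Sq a j, ∑ x ∈ SX a j q, T a y j q x
        ≤ ∑ j ∈ Finset.range (k + 1),
            K * O1 * ((6 * L) ^ 4 * ℓ j) * (A * Real.exp (-(1 / 2) * (κ₁ - 1) * n a y)) :=
          Finset.sum_le_sum fun j hj' => hLq a ha y hy j hj'
      _ = K * O1 * (A * Real.exp (-(1 / 2) * (κ₁ - 1) * n a y)) *
            ∑ j ∈ Finset.range (k + 1), (6 * L) ^ 4 * ℓ j := by
          rw [Finset.mul_sum]; refine Finset.sum_congr rfl fun j _ => by ring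
      _ ≤ K * O1 * (A * Real.exp (-(1 / 2) * (κ₁ - 1) * n a y)) * (2 * (6 * L) ^ 4) :=
          mul_le_mul_of_nonneg_left hj (by positivity)
      _ = _ := by ring
  -- level Y₀
  have hLY : ∀ a ∈ S0, ∑ y ∈ SY a, ∑ j ∈ Finset.range (k + 1), ∑ q ∈ Sq a j, ∑ x ∈ SX a j q, T a y j q x
      ≤ K * O1 * (2 * (6 * L) ^ 4) * A * Real.exp 1 := by
    intro a ha
    calc ∑ y ∈ SY a, ∑ j ∈ Finset.range (k + 1), ∑ q ∈ Sq a j, ∑ x ∈ SX a j q, T a y j q x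
        ≤ ∑ y ∈ SY a, K * O1 * (2 * (6 * L) ^ 4) * (A * Real.exp (-(1 / 2) * (κ₁ - 1) * n a y)) :=
          Finset.sum_le_sum fun y hy => hLj a ha y hy
      _ = K * O1 * (2 * (6 * L) ^ 4) * A * ∑ y ∈ SY a, Real.exp (-(1 / 2) * (κ₁ - 1) * n a y) := by
          rw [Finset.mul_sum]; refine Finset.sum_congr rfl fun y _ => by ring
      _ ≤ K * O1 * (2 * (6 * L) ^ 4) * A * Real.exp 1 := mul_le_mul_of_nonneg_left (hY a ha) (by positivity)
  -- level □₀ and the exponent identity (1.29)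
  calc ∑ a ∈ S0, ∑ y ∈ SY a, ∑ j ∈ Finset.range (k + 1), ∑ q ∈ Sq a j, ∑ x ∈ SX a j q, T a y j q x
      ≤ S0.card * (K * O1 * (2 * (6 * L) ^ 4) * A * Real.exp 1) := sum_le_card_mul _ _ _ hLY
    _ ≤ Real.exp ((1 / 16) * (κ₁ - 2) * d) * (K * O1 * (2 * (6 * L) ^ 4) * A * Real.exp 1) :=
        mul_le_mul_of_nonneg_right h0 (by positivity)
    _ = K * O1 * (2 * (6 * L) ^ 4) * Real.exp 1 * (A * Real.exp ((1 / 16) * (κ₁ - 2) * d)) := by ring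
    _ = _ := by rw [hA, exponent_129]; ring

/-! ## §3. The p. 9 resummation of the (I.3.7)-type terms with the scale-honest □′-count -/

/-- **p. 9, the resummation of the (I.3.7)-type terms** — the NESTED-SUM BOOKKEEPING of `B13Lemma1Eq130.gather_p9`
(□ ∈ `Sc`, j ≤ k, □′ ∈ `Sq □ j`, X ∈ `SX □ j □′`; terms bounded by K′ times the first exponential of (1.30)
`exp(−½δ₀M(L^jη)⁻¹ − ½δ₀dist^{(ξ)}(□′, □))` times the (1.32)-form `exp(−(1 − δ)κd_k(Y) − δκd_j(X))`) with the
□′-LEVEL BOUND HONEST IN THE SCALE: `Σ_{□′∈Sq □ j} exp(−½δ₀dist^{(ξ)}(□′, □)) ≤ O₂·(L^jη)⁻⁴` (`hq`; the cubes of π_j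
inside the k-scale cube □ alone number (2(L^jη)⁻¹)⁴), the first exponential supplying (L^jη)⁵ under δ₀M ≥ 10e⁻¹
(`factor_Ljη_pow5`; print: *"The first term under the exponential gives also the factor L^jη"*), Σ_j L^jη ≤ 2
(`B13Lemma1Eq130.jsum_le_two`, L ≥ 2) and the □-count carried as an abstract bound `#{□} ≤ Cnt` (`hc`; print:
*"M⁻⁴|Y| ≤ 3·2³d_k(Y) ≤ exp δκd_k(Y)"*, inner step false for degenerate Y — cell GAPS G-B13-07 — so the torus supplies
the repaired `64·e^{δκd_k(Y)}`, `B13Lemma1Torus.card_le_mul_exp_torus`).  CONCLUSION: `2K′O(1)O₂·Cnt·exp(−(1 − δ)κd_k(Y))`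
(with Cnt = e^{δκd_k(Y)} this is print's `2K′O(1)O₂·exp(−(1 − 2δ)κd_k(Y))`, the shape of `B13Lemma1TorusFull.gather_p9_count`).
[cite: Balaban1988RG2Cluster, p.9 (before Lemma 1)] -/
theorem gather_p9_dep {α : Type*} {γ δ : ℕ → Type*} (Sc : Finset α) (k : ℕ) (Sq : α → (j : ℕ) → Finset (γ j))
    (SX : α → (j : ℕ) → γ j → Finset (δ j)) (T : α → (j : ℕ) → γ j → δ j → ℝ) (dist : α → (j : ℕ) → γ j → ℝ)
    (dj : α → (j : ℕ) → γ j → δ j → ℝ)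
    {K' O1 O₂ L δ₀ M δ κ d Cnt : ℝ} (hK' : 0 ≤ K') (hO1 : 0 ≤ O1) (hO₂ : 0 ≤ O₂) (hL : 2 ≤ L)
    (ha : 10 * Real.exp (-1) ≤ δ₀ * M)
    (hT : ∀ c ∈ Sc, ∀ j ∈ Finset.range (k + 1), ∀ q ∈ Sq c j, ∀ x ∈ SX c j q,
      T c j q x ≤ K' * Real.exp (-(1 / 2) * (δ₀ * M) * (L ^ j * (L ^ k)⁻¹)⁻¹ - (1 / 2) * δ₀ * dist c j q) *
        Real.exp (-(1 - δ) * κ * d - δ * κ * dj c j q x))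
    (hX : ∀ c ∈ Sc, ∀ j ∈ Finset.range (k + 1), ∀ q ∈ Sq c j,
      ∑ x ∈ SX c j q, Real.exp (-(δ * κ * dj c j q x)) ≤ O1)
    (hq : ∀ c ∈ Sc, ∀ j ∈ Finset.range (k + 1),
      ∑ q ∈ Sq c j, Real.exp (-((1 / 2) * δ₀ * dist c j q)) ≤ O₂ * ((L ^ j * (L ^ k)⁻¹) ^ 4)⁻¹)
    (hc : (Sc.card : ℝ) ≤ Cnt) :
    ∑ c ∈ Sc, ∑ j ∈ Finset.range (k + 1), ∑ q ∈ Sq c j, ∑ x ∈ SX c j q, T c j q x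
      ≤ 2 * K' * O1 * O₂ * Cnt * Real.exp (-(1 - δ) * κ * d) := by
  set ℓ : ℕ → ℝ := fun j => L ^ j * (L ^ k)⁻¹ with hℓdef
  have hL0 : 0 < L := by linarith
  have hℓpos : ∀ j, 0 < ℓ j := fun j => by positivity
  set A := Real.exp (-(1 - δ) * κ * d) with hA
  have hsplit : ∀ c j q x,
      K' * Real.exp (-(1 / 2) * (δ₀ * M) * (ℓ j)⁻¹ - (1 / 2) * δ₀ * dist c j q) *
          Real.exp (-(1 - δ) * κ * d - δ * κ * dj c j q x)
        = K' * A * Real.exp (-(1 / 2) * (δ₀ * M) * (ℓ j)⁻¹) * Real.exp (-((1 / 2) * δ₀ * dist c j q)) *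
            Real.exp (-(δ * κ * dj c j q x)) := by
    intro c j q x
    rw [hA]
    have e1 : Real.exp (-(1 / 2) * (δ₀ * M) * (ℓ j)⁻¹ - (1 / 2) * δ₀ * dist c j q)
        = Real.exp (-(1 / 2) * (δ₀ * M) * (ℓ j)⁻¹) * Real.exp (-((1 / 2) * δ₀ * dist c j q)) := by
      rw [← Real.exp_add]; ring_nf
    have e2 : Real.exp (-(1 - δ) * κ * d - δ * κ * dj c j q x)
        = Real.exp (-(1 - δ) * κ * d) * Real.exp (-(δ * κ * dj c j q x)) := by
      rw [← Real.exp_add]; ring_nf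
    rw [e1, e2]; ring
  -- level X
  have hLX : ∀ c ∈ Sc, ∀ j ∈ Finset.range (k + 1), ∀ q ∈ Sq c j,
      ∑ x ∈ SX c j q, T c j q x
        ≤ K' * A * Real.exp (-(1 / 2) * (δ₀ * M) * (ℓ j)⁻¹) * Real.exp (-((1 / 2) * δ₀ * dist c j q)) * O1 := by
    intro c hc' j hj q hq'
    calc ∑ x ∈ SX c j q, T c j q x
        ≤ ∑ x ∈ SX c j q, K' * A * Real.exp (-(1 / 2) * (δ₀ * M) * (ℓ j)⁻¹) *
            Real.exp (-((1 / 2) * δ₀ * dist c j q)) * Real.exp (-(δ * κ * dj c j q x)) :=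
          Finset.sum_le_sum fun x hx => by rw [← hsplit]; exact hT c hc' j hj q hq' x hx
      _ = K' * A * Real.exp (-(1 / 2) * (δ₀ * M) * (ℓ j)⁻¹) * Real.exp (-((1 / 2) * δ₀ * dist c j q)) *
            ∑ x ∈ SX c j q, Real.exp (-(δ * κ * dj c j q x)) := by rw [Finset.mul_sum]
      _ ≤ _ := mul_le_mul_of_nonneg_left (hX c hc' j hj q hq') (by positivity)
  -- level □′: the first exponential gives (L^jη)⁵, the □′-sum costs (L^jη)⁻⁴
  have hLq : ∀ c ∈ Sc, ∀ j ∈ Finset.range (k + 1),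
      ∑ q ∈ Sq c j, ∑ x ∈ SX c j q, T c j q x ≤ K' * A * O1 * O₂ * ℓ j := by
    intro c hc' j hj
    have hfac : Real.exp (-(1 / 2) * (δ₀ * M) * (ℓ j)⁻¹) ≤ ℓ j ^ 5 := factor_Ljη_pow5 (hℓpos j) ha
    have hO₂' : ∑ q ∈ Sq c j, Real.exp (-((1 / 2) * δ₀ * dist c j q)) ≤ O₂ * (ℓ j ^ 4)⁻¹ := hq c hc' j hj
    have hprod : Real.exp (-(1 / 2) * (δ₀ * M) * (ℓ j)⁻¹) *
        ∑ q ∈ Sq c j, Real.exp (-((1 / 2) * δ₀ * dist c j q)) ≤ ℓ j * O₂ := by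
      calc Real.exp (-(1 / 2) * (δ₀ * M) * (ℓ j)⁻¹) * ∑ q ∈ Sq c j, Real.exp (-((1 / 2) * δ₀ * dist c j q))
          ≤ ℓ j ^ 5 * (O₂ * (ℓ j ^ 4)⁻¹) :=
            mul_le_mul hfac hO₂' (Finset.sum_nonneg fun q _ => (Real.exp_pos _).le) (by positivity)
        _ = ℓ j * O₂ := by field_simp
    calc ∑ q ∈ Sq c j, ∑ x ∈ SX c j q, T c j q x
        ≤ ∑ q ∈ Sq c j, K' * A * Real.exp (-(1 / 2) * (δ₀ * M) * (ℓ j)⁻¹) *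
            Real.exp (-((1 / 2) * δ₀ * dist c j q)) * O1 :=
          Finset.sum_le_sum fun q hq' => hLX c hc' j hj q hq'
      _ = K' * A * O1 * (Real.exp (-(1 / 2) * (δ₀ * M) * (ℓ j)⁻¹) *
            ∑ q ∈ Sq c j, Real.exp (-((1 / 2) * δ₀ * dist c j q))) := by
          rw [Finset.mul_sum, Finset.mul_sum]; refine Finset.sum_congr rfl fun q _ => by ring
      _ ≤ K' * A * O1 * (ℓ j * O₂) := mul_le_mul_of_nonneg_left hprod (by positivity)
      _ = K' * A * O1 * O₂ * ℓ j := by ring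
  -- level j
  have hLj : ∀ c ∈ Sc,
      ∑ j ∈ Finset.range (k + 1), ∑ q ∈ Sq c j, ∑ x ∈ SX c j q, T c j q x ≤ K' * A * O1 * O₂ * 2 := by
    intro c hc'
    calc ∑ j ∈ Finset.range (k + 1), ∑ q ∈ Sq c j, ∑ x ∈ SX c j q, T c j q x
        ≤ ∑ j ∈ Finset.range (k + 1), K' * A * O1 * O₂ * ℓ j := Finset.sum_le_sum fun j hj => hLq c hc' j hj
      _ = K' * A * O1 * O₂ * ∑ j ∈ Finset.range (k + 1), ℓ j := by rw [Finset.mul_sum]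
      _ ≤ K' * A * O1 * O₂ * 2 := mul_le_mul_of_nonneg_left (jsum_le_two hL k) (by positivity)
  -- level □: the outer □-count (print: M⁻⁴|Y| ≤ 3·2³d_k(Y) ≤ exp δκd_k(Y); carried as `Cnt`)
  calc ∑ c ∈ Sc, ∑ j ∈ Finset.range (k + 1), ∑ q ∈ Sq c j, ∑ x ∈ SX c j q, T c j q x
      ≤ Sc.card * (K' * A * O1 * O₂ * 2) := sum_le_card_mul _ _ _ hLj
    _ ≤ Cnt * (K' * A * O1 * O₂ * 2) := mul_le_mul_of_nonneg_right hc (by positivity)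
    _ = 2 * K' * O1 * O₂ * Cnt * A := by ring

end Literature.MathematicalPhysics.QuantumFieldTheory.Balaban1983to89.B13Lemma1DepGather
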